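import Summits.ABC.IUTFork.LDHSUnitFamilyMixedSum
import HarnessLib

/-!
# The (U)-line CONE binder `hvol` / `hreg` is FALSE as typed — at EVERY fixed prime `l ≥ 173` — witnessed by the S-unit
# quadratic family (abc-iut R2 S-chain team, TARGET #1 «hvol residue», seat abc-iut-s2-p4 gen 4)

Record-only PROOF file (D-0012) of the abc-iut cell; TAKES NO SIDE on [IUTchIII] Cor. 3.12, on [IUTchIV] Thm. 1.10, or on any author.
S. Mochizuki, *IUT IV* [Mochizuki2012], Thm. 1.10 proof Steps (ii), (v) pp. 24–28; Cor. 2.2 (ii) proof (P1)–(P7) pp. 45–46;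
[MochizukiGenEll2010] Ex. 1.3 (ii) p. 5; Dupuy–Hilado [DupuyHilado2025] §3.3, §3.6, §4.7, §4.11–4.12; cell note plan/c312/STEPV-IND1-NOTE.md
(reading (U): (Ind1) = all capsule-index permutations; the hull of the UNION realises the mixed share).

WHAT IS PROVED (all inputs are tree theorems, consumed BY NAME):
* `SUnitFamily.mixedSum_eq` / `notBadWeight_eq` — at the points `P_{a,c} = (F_{a,c}, λ_{a,c})` of `LDHSUnitFamily{Field,Valuations,Poles,Point}`
  (`ℚ(j(λ)) = F`, places of `ℚ(j(λ))` = places of `F` by abc-iut-s2-p3's transport), the datum-free mixed sum of abc-iut-s2-p1's sharp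
  necessity at the MIXED prime `5` (`W = {5}`) EQUALS `(a·log 5/(2l))·(l(l+1)/12 − 16/(l−1))` and `ω₅ = 1/2`;
* `SUnitFamily.false_of_slack` — the CORE arithmetic: with `d_mod = 2`, `log 𝔣 ≤ ½(log 5 + 2 log 7)`, `log-diff ≤ a·log 5 + ½ log 5`
  (part III), the slack inequality «mixed sum ≤ (4d−1+3d/l)(lD+lC) + ((l+5−4d)/(4l))·lC + ((l+1)/4)·E(l)» forces
  `m(l)·a·log 5 ≤ K(l)` with `m(l) = (l+1)/24 − 8/(l(l−1)) − 7 − 6/l > 1/5` for `l ≥ 173` — FALSE for `a` large;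
* **`SUnitFamily.not_hullVolumeAtDatum_BIII_at_prime`** — for EVERY prime `l ≥ 173`: `¬ (∀ P ∈ UP, AdmitsCore P → CondP2 P l → CondP5 P l →
  CondP6 P l → Cor22.HullVolumeAtDatum P l (B_III P l))` — the (U)-line computable half with print's `B_III` FAILS at some admissible point
  AT THAT `l` (exponents `a, c ≡ 1 (mod l)` give (P2); (P6) above a height by the tree's PROVED (P4) ⟹ (P6) `Cor22.condP6_of_seven_le` on
  `K_∞(5^l)`; a datum by abc-iut-L5-t7's `ThetaPartII.stub_thetaData`; abc-iut-s2-p1/S4/w6-d018's `pointMixedShare_le_sub_gain_of_hullVolumeAtDatum`);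
* **`Conditional.not_hreg_at_prime`** — for EVERY prime `l ≥ 173`: `¬ hreg` for the CONE binder of `abc_of_S_v4` / `abc_of_SH_v6K` /
  `abc_of_SH_v10M` VERBATIM, witnessed AT THAT `l` (abc-iut-s2-p1's `pointMixedShare_le_slack_eventually_of_hreg`, mixed pair `(𝔭₁, 𝔭₂)` over `5`).
COMPLEMENT, NOT TWIN: the unparametrised negations `Conditional.not_hvol_v3` / `Conditional.not_hreg_v4` are abc-iut-s2-p5's
(`Conditional/AbcOfSHvolRefutation.lean`, «HVOL-REFUTATION-QUADWITNESS», along the (P1)-WINDOW primes `l ~ √h` of its family over `ℚ(√2)`) and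
are NOT restated here (they follow from the theorems below at `l = 173` by `fun h => not_… (fun P hP … => h P hP 173 …)`); here `l` is ANY FIXED
prime `≥ 173` and the conductor is CONSTANT along the family — so no restriction of the binder to a residue class or size range of `l` rescues it. HONEST SCOPE: a statement about OUR typed objects under reading (U)
(the defined nonarchimedean hull volume of the typed multiradial region exceeds print's `B_III(λ, l)` at explicit admissible `d_mod = 2` data);
the `d_mod = 1` / slot-constant / equal-heights cuts remain THEOREMS; nothing about [IUTchIII] Cor. 3.12; (R3) (a reading of (Ind1) fixing
the distinguished index) would change the typed region. no side taken; typed ≠ proved.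
[cite: Mochizuki2012, IUTchIV Thm. 1.10 proof Step (ii) p. 24, Step (v) p. 27–28] [cite: Mochizuki2012, IUTchIV Cor. 2.2 (ii) proof (P1)-(P7) pp. 45–46]
[cite: MochizukiGenEll2010, Ex 1.3 (ii) p.5] [cite: DupuyHilado2025, §3.3, §3.6, §4.7, §4.12] [claim: Mochizuki2012, status: disputed]
for every IUT quotation.
-/

noncomputable section

namespace Summit.ABC.IUTFork

open NumberField IsDedekindDomain Literature.IUT.LogVolume Literature.IUT.LogVolume.Cor22 Literature.IUT.HodgeTheaters
open Literature.NumberTheory.DiophantineGeometry.GenEll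
open scoped Classical

namespace SUnitFamily

/-! ## The refutation at a FIXED prime `l ≥ 173` -/

/-- Real arithmetic of the slack (a copy of abc-iut-s2-p1's private `le_slack_of_add_gain_le`): `δ = ((l+1)/4)·((1+12d/l)(lD+lC) + R)`,
`lD + (1−1/l)·lC ≤ G`, `4d ≤ l+5` and `x ≤ δ − ((l+5)/4 − d)·G` give `x ≤ (4d − 1 + 3d/l)(lD+lC) + ((l+5−4d)/(4l))·lC + ((l+1)/4)·R`. [folklore] -/
private theorem le_slack_of_add_gain_le {l d lD lC R δ G x : ℝ} (hl : 0 < l)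
    (hδ : δ = (l + 1) / 4 * ((1 + 12 * d / l) * (lD + lC) + R))
    (hG : lD + (1 - 1 / l) * lC ≤ G) (h4d : 4 * d ≤ l + 5) (hx : x ≤ δ - ((l + 5) / 4 - d) * G) :
    x ≤ (4 * d - 1 + 3 * d / l) * (lD + lC) + (l + 5 - 4 * d) / (4 * l) * lC + (l + 1) / 4 * R := by
  have hc : 0 ≤ (l + 5) / 4 - d := by linarith
  have h1 : ((l + 5) / 4 - d) * (lD + (1 - 1 / l) * lC) ≤ ((l + 5) / 4 - d) * G := mul_le_mul_of_nonneg_left hG hc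
  have key : (l + 1) / 4 * ((1 + 12 * d / l) * (lD + lC) + R) - ((l + 5) / 4 - d) * (lD + (1 - 1 / l) * lC)
      = (4 * d - 1 + 3 * d / l) * (lD + lC) + (l + 5 - 4 * d) / (4 * l) * lC + (l + 1) / 4 * R := by
    field_simp
    ring
  linarith [key]

/-- **THE (U)-LINE COMPUTABLE HALF WITH PRINT'S `B_III` FAILS AT EVERY FIXED PRIME `l ≥ 173`.** For every prime `l ≥ 173` it is FALSE that
`Cor22.HullVolumeAtDatum P l (B_III(P, l))` holds at every admissible `P` (minimally presented, admits a core, (P2), (P5), (P6) at THIS `l`):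
at the S-unit points `P_{a,c}` with `a, c ≡ 1 (mod l)`, `7^c ≤ 5^a ≤ 5^l·7^c` and `a` large, (P2)/(P5) hold by parts IIb/III, (P6) by the tree's
PROVED (P4) ⟹ (P6) on `K_∞(5^l)` (`Cor22.condP6_of_seven_le`), a genuine datum exists (`ThetaPartII.stub_thetaData`), and abc-iut-s2-p1's SHARP
necessity `pointMixedShare_le_sub_gain_of_hullVolumeAtDatum` at the mixed prime `5` reads `m(l)·a·log 5 ≤ K(l)` with `m(l) > 0` — absurd.
A statement about OUR typed objects under reading (U); no side taken. [cite: Mochizuki2012, IUTchIV Thm. 1.10 proof Step (v) p. 27–28]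
[cite: Mochizuki2012, IUTchIV Cor. 2.2 (ii) proof (P1)-(P7) pp. 45–46] [claim: Mochizuki2012, status: disputed] -/
theorem not_hullVolumeAtDatum_BIII_at_prime {l : ℕ} (hl : l.Prime) (h173 : 173 ≤ l) :
    ¬ (∀ P : NFPoint, P ∈ UP → Cor22.AdmitsCore P → Cor22.CondP2 P l → Cor22.CondP5 P l → Cor22.CondP6 P l →
        Cor22.HullVolumeAtDatum P l (((l : ℝ) + 1) / 4 *
          ((1 + 12 * (Cor22.dmod P : ℝ) / l) * (P.logDiff + Cor22.logCondAvoid P {2, l})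
            + 2 * Real.log l + 52
            + 20 / 3 * Real.log (((2 ^ 12 * 3 ^ 3 * 5 * Cor22.dmod P : ℕ) : ℝ) * (l : ℝ))
              * (Nat.primeCounting (2 ^ 12 * 3 ^ 3 * 5 * Cor22.dmod P * l) : ℝ)))) := by
  intro hvolAt
  haveI : Fact (Nat.Prime 5) := ⟨by norm_num⟩
  have hl2 : 2 ≤ l := hl.two_le
  have hl5 : l ≠ 5 := by omega
  have hlne2 : l ≠ 2 := by omega
  have hl7 : 7 ≤ l := by omega
  have hlr : (173 : ℝ) ≤ (l : ℝ) := by exact_mod_cast h173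
  have hl0 : (0 : ℝ) < (l : ℝ) := by linarith
  set R : ℝ := (5 : ℝ) ^ l with hRdef
  have hR : 1 ≤ R := one_le_pow₀ (by norm_num)
  obtain ⟨HK, hHK⟩ := Cor22.condP6_of_seven_le (cbTwoDiscs R hR)
  -- the `l`-only part of `B_III` at `d_mod = 2`
  set E : ℝ := 2 * Real.log l + 52 + 20 / 3 * Real.log (1105920 * (l : ℝ)) * ((1105920 * l).primeCounting : ℝ) with hEdef
  set K : ℝ := 5 * (8 * ((Real.log 5 + 2 * Real.log 7) / 2) + 8 * (Real.log 5 / 2) + ((l : ℝ) + 1) / 4 * E) with hKdef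
  have hlog5 : 0 < Real.log 5 := Real.log_pos (by norm_num)
  -- choose the exponents
  obtain ⟨n, hn⟩ := exists_nat_gt (max HK K / Real.log 5)
  obtain ⟨a, c, ha, hc, hla, hlc, hlo, hhi⟩ := exists_exponents l hl2 n
  have ha1 : 1 ≤ a := by omega
  have hc1 : 1 ≤ c := by omega
  have hbig : max HK K < (a : ℝ) * Real.log 5 := by
    have h1 : max HK K < (n : ℝ) * Real.log 5 := by rwa [div_lt_iff₀ hlog5] at hn
    have h2 : (n : ℝ) * Real.log 5 ≤ (a : ℝ) * Real.log 5 :=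
      mul_le_mul_of_nonneg_right (by exact_mod_cast (by omega : n ≤ a)) hlog5.le
    linarith
  -- admissibility of `P_{a,c}` at `l`
  have hP : Pt a c ∈ UP := P_mem_UP ha1 hc1
  have hcore : Cor22.AdmitsCore (Pt a c) := admitsCore_P ha1 hc1
  have h2 : Cor22.CondP2 (Pt a c) l := condP2_P ha1 hc1 hl hlne2 hla hlc
  have h5 : Cor22.CondP5 (Pt a c) l := condP5_P ha1 hc1 hl hl5
  have hd : Cor22.dmod (Pt a c) = 2 := dmod_P ha1 hc1
  have hmem : Pt a c ∈ (cbTwoDiscs R hR).toSet :=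
    P_mem_cbTwoDiscs (a := a) (c := c) hR (by exact_mod_cast hlo) (by rw [hRdef]; exact_mod_cast hhi)
  have hq : (a : ℝ) * Real.log 5 ≤ Cor22.logQForall (Pt a c) := le_logQForall_P ha1 hc1
  have hHK' : HK < Cor22.logQForall (Pt a c) := by linarith [le_max_left HK K]
  have h6 : Cor22.CondP6 (Pt a c) l := hHK (Pt a c) hmem hP l hl hl7 h2 h5 hHK'
  -- the hull volume at the point, a datum, and the sharp necessity at the mixed prime `5`
  have hHV := hvolAt (Pt a c) hP hcore h2 h5 h6
  obtain ⟨T⟩ := Summit.ABC.ABC.Theorems.ThetaPartII.stub_thetaData (Pt a c) hP l hl (by omega) hcore h2 h5 h6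
  have h4d : 4 * (Cor22.dmod (Pt a c) : ℝ) ≤ (l : ℝ) + 5 := by rw [hd]; push_cast; linarith
  obtain ⟨hω, hsum⟩ := mixed_data_at_five ha1 hc1 hl hl5
  have hω' : ∀ p ∈ ({5} : Finset ℕ), 0 < ∑ V ∈ Finset.univ.filter
      (fun V : placesOver ↥(IntermediateField.adjoin ℚ ({Cor22.jInv (Pt a c).x} : Set (Pt a c).F)) p =>
        ¬ (ord _ V.1 (Cor22.jMod (Pt a c)) < 0 ∧ ((2 : ℕ) : 𝓞 _) ∉ V.1.asIdeal ∧ ((l : ℕ) : 𝓞 _) ∉ V.1.asIdeal)),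
      weight _ V.1 := by
    intro p hp
    rw [Finset.mem_singleton] at hp
    subst hp
    rw [hω]; norm_num
  have hineq := PointDict.pointMixedShare_le_sub_gain_of_hullVolumeAtDatum hHV T hl.pos h4d {5}
    (fun p hp => by rw [Finset.mem_singleton] at hp; subst hp; norm_num) hω'
  rw [Finset.sum_singleton, hsum, hω, hd] at hineq
  push_cast at hineq
  -- slack form and the core arithmetic
  have hslack := le_slack_of_add_gain_le (d := 2) (R := E) (lD := (Pt a c).logDiff) (lC := Cor22.logCondAvoid (Pt a c) {2, l}) hl0
    (by rw [hEdef]; ring) le_rfl (by linarith) hineq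
  have hcore_le := core_bound h173 (NFPoint.logDiff_nonneg (Pt a c)) (Cor22.logCondAvoid_nonneg (Pt a c) {2, l})
    (logDiff_le_linear hlo) (logCondAvoid_le ha1 hc1 {2, l}) rfl hslack
  have : K < (a : ℝ) * Real.log 5 := lt_of_le_of_lt (le_max_right HK K) hbig
  rw [hKdef] at this
  linarith

end SUnitFamily

namespace Conditional

/-- **`hreg` FAILS through every fixed prime `l ≥ 173`**: from the CONE binder `hreg` (VERBATIM; the binder of `abc_of_S_v4` / `abc_of_SH_v6K` /
`abc_of_SH_v10M`, cf. abc-iut-s2-p5's unparametrised `Conditional.not_hreg_v4`) abc-iut-s2-p1's eventual sharp necessity at the S-unit points with the mixed pair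
`(𝔭₁, 𝔭₂)` over `5` reads `m(l)·a·log 5 ≤ K(l)` — absurd for `a` large. [cite: Mochizuki2012, IUTchIV Thm. 1.10 proof Step (v) p. 27–28]
[claim: Mochizuki2012, status: disputed] -/
theorem not_hreg_at_prime {l : ℕ} (hl : l.Prime) (h173 : 173 ≤ l) :
    ¬ (∀ P : NFPoint, P ∈ UP → ∀ l : ℕ, l.Prime → 5 ≤ l →
      Cor22.AdmitsCore P → Cor22.CondP2 P l → Cor22.CondP5 P l → Cor22.CondP6 P l →
      ∀ T : Cor22.ThetaVolumeDatumAt P l,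
        (letI := T.instFieldF; letI := T.instNumberFieldF; letI := T.instAlgebraF; letI := T.instFieldK
         letI := T.instNumberFieldK; letI := T.instAlgebraK; letI := T.instFieldFbar; letI := T.instAlgebraFbar
         letI := T.instAlgebraKFbar; letI := T.instIsElliptic
         ¬ (∀ p ∈ T.I.supportPrimes, ∀ v w : placesOver (fieldOfModuli T.E) p,
            (Summit.ABC.IUTFork.DHData.ofInput T.I).logQloc p v = (Summit.ABC.IUTFork.DHData.ofInput T.I).logQloc p w)) →
        T.HullEstimateOf
          (((l : ℝ) + 1) / 4 *
            ((1 + 12 * (Cor22.dmod P : ℝ) / l) * (P.logDiff + Cor22.logCondAvoid P {2, l})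
              + 2 * Real.log l + 52
              + 20 / 3 * Real.log (((2 ^ 12 * 3 ^ 3 * 5 * Cor22.dmod P : ℕ) : ℝ) * (l : ℝ))
                * (Nat.primeCounting (2 ^ 12 * 3 ^ 3 * 5 * Cor22.dmod P * l) : ℝ)))) := by
  intro hreg
  haveI : Fact (Nat.Prime 5) := ⟨by norm_num⟩
  have hl2 : 2 ≤ l := hl.two_le
  have hl5 : l ≠ 5 := by omega
  have hlne2 : l ≠ 2 := by omega
  have hl7 : 7 ≤ l := by omega
  have hlr : (173 : ℝ) ≤ (l : ℝ) := by exact_mod_cast h173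
  have hl0 : (0 : ℝ) < (l : ℝ) := by linarith
  set R : ℝ := (5 : ℝ) ^ l with hRdef
  have hR : 1 ≤ R := one_le_pow₀ (by norm_num)
  obtain ⟨HK, hHK⟩ := PointDict.pointMixedShare_le_slack_eventually_of_hreg hreg (SUnitFamily.cbTwoDiscs R hR)
  set K : ℝ := 5 * (8 * ((Real.log 5 + 2 * Real.log 7) / 2) + 8 * (Real.log 5 / 2) + ((l : ℝ) + 1) / 4 *
    (2 * Real.log l + 52 + 20 / 3 * Real.log (1105920 * (l : ℝ)) * ((1105920 * l).primeCounting : ℝ))) with hKdef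
  have hlog5 : 0 < Real.log 5 := Real.log_pos (by norm_num)
  obtain ⟨n, hn⟩ := exists_nat_gt (max HK K / Real.log 5)
  obtain ⟨a, c, ha, hc, hla, hlc, hlo, hhi⟩ := SUnitFamily.exists_exponents l hl2 n
  have ha1 : 1 ≤ a := by omega
  have hc1 : 1 ≤ c := by omega
  have hbig : max HK K < (a : ℝ) * Real.log 5 := by
    have h1 : max HK K < (n : ℝ) * Real.log 5 := by rwa [div_lt_iff₀ hlog5] at hn
    have h2 : (n : ℝ) * Real.log 5 ≤ (a : ℝ) * Real.log 5 :=
      mul_le_mul_of_nonneg_right (by exact_mod_cast (by omega : n ≤ a)) hlog5.le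
    linarith
  have hP : SUnitFamily.Pt a c ∈ UP := SUnitFamily.P_mem_UP ha1 hc1
  have hcore := SUnitFamily.admitsCore_P ha1 hc1
  have h2 : Cor22.CondP2 (SUnitFamily.Pt a c) l := SUnitFamily.condP2_P ha1 hc1 hl hlne2 hla hlc
  have h5 : Cor22.CondP5 (SUnitFamily.Pt a c) l := SUnitFamily.condP5_P ha1 hc1 hl hl5
  have hd : Cor22.dmod (SUnitFamily.Pt a c) = 2 := SUnitFamily.dmod_P ha1 hc1
  have hmem : SUnitFamily.Pt a c ∈ (SUnitFamily.cbTwoDiscs R hR).toSet :=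
    SUnitFamily.P_mem_cbTwoDiscs (a := a) (c := c) hR (by exact_mod_cast hlo) (by rw [hRdef]; exact_mod_cast hhi)
  have hq : (a : ℝ) * Real.log 5 ≤ Cor22.logQForall (SUnitFamily.Pt a c) := SUnitFamily.le_logQForall_P ha1 hc1
  have hHK' : HK < Cor22.logQForall (SUnitFamily.Pt a c) := by linarith [le_max_left HK K]
  have h4d : 4 * (Cor22.dmod (SUnitFamily.Pt a c) : ℝ) ≤ (l : ℝ) + 5 := by rw [hd]; push_cast; linarith
  -- the mixed pair `(𝔭₁, 𝔭₂)` over `5`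
  obtain ⟨𝔭₁, 𝔭₂, -, -, ⟨k1, k1', k15, ko1⟩, ⟨k2, -, k25, -⟩, -, -⟩ := SUnitFamily.exists_four_places ha1 hc1
  have hv1 : 𝔭₁ ∈ placesOver (SUnitFamily.Pt a c).F 5 := Cor22.mem_placesOver_of_natCast_mem 5 𝔭₁ k15
  have hv2 : 𝔭₂ ∈ placesOver (SUnitFamily.Pt a c).F 5 := Cor22.mem_placesOver_of_natCast_mem 5 𝔭₂ k25
  have hord1 : ord (SUnitFamily.Pt a c).F 𝔭₁ (Cor22.jInv (SUnitFamily.Pt a c).x) = -(2 * (a : ℤ)) :=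
    (SUnitFamily.ord_at_p1 hc1 k15 k1 k1' ko1).1
  have hord2 : 0 ≤ ord (SUnitFamily.Pt a c).F 𝔭₂ (Cor22.jInv (SUnitFamily.Pt a c).x) := (SUnitFamily.ord_at_p2 hc1 k25 k2).1
  have hV : 𝔭₁ ∈ Cor22.badPlacesAvoid (SUnitFamily.Pt a c) {2, l} := by
    unfold Cor22.badPlacesAvoid
    rw [Finset.mem_filter, Cor22.mem_badPlaces_iff_ord_neg]
    refine ⟨by rw [hord1]; omega, fun p hp => ?_⟩
    simp only [Finset.mem_insert, Finset.mem_singleton] at hp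
    rcases hp with rfl | rfl
    · exact SplitDepth.natCast_not_mem_of_prime_ne ⟨𝔭₁, hv1⟩ Nat.prime_two (by norm_num)
    · exact SplitDepth.natCast_not_mem_of_prime_ne ⟨𝔭₁, hv1⟩ hl hl5
  have hW : 𝔭₂ ∈ Cor22.badPlacesAvoid (SUnitFamily.Pt a c) {2, l} →
      (ord (SUnitFamily.Pt a c).F 𝔭₁ (Cor22.jInv (SUnitFamily.Pt a c).x) : ℝ) * logNorm (SUnitFamily.Pt a c).F 𝔭₁ /
          (localDegree (SUnitFamily.Pt a c).F 𝔭₁ : ℝ) ≠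
        (ord (SUnitFamily.Pt a c).F 𝔭₂ (Cor22.jInv (SUnitFamily.Pt a c).x) : ℝ) * logNorm (SUnitFamily.Pt a c).F 𝔭₂ /
          (localDegree (SUnitFamily.Pt a c).F 𝔭₂ : ℝ) := by
    intro h
    exfalso
    unfold Cor22.badPlacesAvoid at h
    rw [Finset.mem_filter, Cor22.mem_badPlaces_iff_ord_neg] at h
    exact absurd hord2 (not_le.mpr h.1)
  obtain ⟨hω, hsum⟩ := SUnitFamily.mixed_data_at_five ha1 hc1 hl hl5
  have hω' : ∀ p ∈ ({5} : Finset ℕ), 0 < ∑ V ∈ Finset.univ.filter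
      (fun V : placesOver ↥(IntermediateField.adjoin ℚ ({Cor22.jInv (SUnitFamily.Pt a c).x} : Set (SUnitFamily.Pt a c).F)) p =>
        ¬ (ord _ V.1 (Cor22.jMod (SUnitFamily.Pt a c)) < 0 ∧ ((2 : ℕ) : 𝓞 _) ∉ V.1.asIdeal ∧ ((l : ℕ) : 𝓞 _) ∉ V.1.asIdeal)),
      weight _ V.1 := by
    intro p hp
    rw [Finset.mem_singleton] at hp
    subst hp
    rw [hω]; norm_num
  have hineq := hHK (SUnitFamily.Pt a c) hmem hP l hl hl7 hcore h2 h5 h4d hHK' 5 𝔭₁ 𝔭₂ hv1 hv2 hV hW {5}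
    (fun p hp => by rw [Finset.mem_singleton] at hp; subst hp; norm_num) hω'
  rw [Finset.sum_singleton, hsum, hω, hd] at hineq
  push_cast at hineq
  have hcore_le := SUnitFamily.core_bound h173 (NFPoint.logDiff_nonneg (SUnitFamily.Pt a c))
    (Cor22.logCondAvoid_nonneg (SUnitFamily.Pt a c) {2, l}) (SUnitFamily.logDiff_le_linear hlo)
    (SUnitFamily.logCondAvoid_le ha1 hc1 {2, l}) rfl hineq
  have : K < (a : ℝ) * Real.log 5 := lt_of_le_of_lt (le_max_right HK K) hbig
  rw [hKdef] at this
  linarith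

end Conditional

end Summit.ABC.IUTFork

end
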